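import Literature.MathematicalPhysics.QuantumFieldTheory.Balaban1983to89.B8Ineq159FlatShellModeCrossingDatum

/-!
# `Balaban1983to89.B8Eq138LandauFlatOrthogonal` — [Balaban1985RegularSpaces] (1.38) p. 82 ∕ [Balaban1984PropagatorsII] (2.12) p. 225 AT THE FLAT BACKGROUND:
# the tree's MULTIPLIER FORM of the Landau condition (`B8Eq138LandauZd.IsLandau138 … 1 φ`: «Δ^η_1(𝟙_{Ω₀}·D^{η*}_1φ) = Q′(1)ᵀμ on Ω₀») IMPLIES print's
# ORTHOGONALITY FORM «R D*A = 0»: `Σ_x (Δ^η_1λ)(x)·(𝟙_{Ω₀}D^{η*}_1φ)(x) = 0` for every gauge function `λ ∈ N(Q′)` — `λ` supported in `Ω₀`, `λ = 0` on `Λ₀`,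
# vanishing `Lʲ`-block sums on the blocks of `Λ_j`, `j ≥ 1` — the pairing by which lit-balaban p21's V1 calculus states (2.12)
# (`B6SectAOperatorsV1.RE_eq_zero_iff`: `R∂*A = 0 ⇔ ⟨Δμ, ∂*A⟩ = 0 ∀ μ ∈ N(Q′)`): the Landau half of the cube → torus transplant dictionary for N05's flat road

statement-level skeleton of published theorems with citation tags; proofs where landed; nothing here is a claim about the
Yang–Mills mass gap

`[Balaban1985RegularSpaces]` (1.38) p. 82 («R(U₀)D^{η*}_{U₀}A = 0»), (1.29) p. 81; `[Balaban1984PropagatorsII]` (2.7) p. 224 («λ = 0 on Λ₀, Q′_jλ = 0 on Λ_j»), (2.10)–(2.12)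
p. 225 («let R be an orthogonal projection in the space L²(T_η) onto the subspace ΔN(Q′) … Rd*A = 0»); `[Balaban1985BackgroundPropagators]` (3.19) p. 393, (3.23)–(3.25)
p. 394.  PDF held: `paper:balaban1984-cmp96-propagators-rt-ii` p. 225 (re-read this session).

CITATION HEADER (lean-in-tree rule).  Cell `pub-ymgap` (YM Track A, HUMAN RULING D-0062), DAG node N05 = [B8], seat `pub-ymgap-dag-n05-c` (g11), INTENT-6.
WHY: the repaired flat (1.59) target `B8Ineq159FlatCubeMemberPrinted.Ineq159FlatCubeMemberPrinted` is to be DISCHARGED by transplanting lit-balaban's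
torus-with-level-0 (1.59) (G-F3′-L0), whose Landau hypothesis is p21's `RE D c (dsE c A) = 0` = «⟨Δλ, ∂*A⟩ = 0 for all λ ∈ N(Q′)» — the ORTHOGONALITY form;
the cube member's hypothesis is the tree's MULTIPLIER form `IsLandau138`.  THIS FILE proves multiplier ⇒ orthogonality on `ℤᵈ` at `U₀ = 1` (the
summation by parts is `B8Ineq159FlatShellModeCrossingDatum.finsum_mul_covLap_symm`; the flat transposes are `B8Eq191FlatStencils.QT_flat_apply`).

HONEST SCOPE.  Flat lattice bookkeeping; nothing of Bałaban's analysis asserted; count-neutral; N05 NOT discharged; one finite `T⁴` programme at fixed `ε`,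
Bałaban as printed; nothing continuum ∕ ℝ⁴ ∕ OS ∕ mass-gap ∕ Clay.  No `sorry`, no `def`, no `instance`, no `notation`.  Unit `pub-ymgap-dag-n05-c` (g11), 2026-08-27.
-/

noncomputable section

namespace Literature.MathematicalPhysics.QuantumFieldTheory.Balaban1983to89.B8Eq138LandauFlatOrthogonal

open B7Prop1Explicit
open B8Eq138LandauZd (IsLandau138 covLap covDivB QT)
open B8Eq191FlatStencils (QT_flat_apply)
open B8Ineq159FlatShellModeCrossingDatum (finsum_mul_covLap_symm support_covLap_finite)
open Literature.MathematicalPhysics.QuantumLattice (blockMap blockSites mem_blockSites_iff blockMap_one)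

export B7Prop1Explicit (Site)

variable {d : ℕ}

/-- A block-fiber sum: `Σ_{x ∈ S} ν(x)·g(block of x) = Σ_{y ∈ blocks} g(y)·Σ_{x ∈ B(y)} ν(x)` for `ν` supported in `S` (bookkeeping of (3.19)'s
transpose «Q′ᵀ»). [cite: Balaban1985BackgroundPropagators, (3.19) p.393; Balaban1985Averaging, (2) p.17] -/
theorem sum_mul_comp_blockMap {N : ℕ} [NeZero N] {ν : Site d → ℂ} {S : Finset (Site d)} (hS : Function.support ν ⊆ ↑S)
    (g : Site d → ℂ) :
    ∑ x ∈ S, ν x * g (blockMap N x) = ∑ y ∈ S.image (blockMap N), g y * ∑ x ∈ blockSites N y, ν x := by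
  classical
  symm
  refine Finset.sum_image' (fun x => ν x * g (blockMap N x)) fun c _ => ?_
  -- the block `B(blockMap c)` against the fiber of `blockMap` over `blockMap c` inside `S`
  have hfib : ∑ x ∈ S with blockMap N x = blockMap N c, ν x * g (blockMap N x) =
      ∑ x ∈ S with blockMap N x = blockMap N c, g (blockMap N c) * ν x := by
    refine Finset.sum_congr rfl fun x hx => ?_
    rw [Finset.mem_filter] at hx
    rw [hx.2, mul_comm]
  rw [hfib, Finset.mul_sum]
  refine (Finset.sum_subset (fun x hx => ?_) (fun x hxB hxS => ?_)).symm
  · rw [Finset.mem_filter] at hx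
    rw [mem_blockSites_iff]; exact hx.2
  · rw [mem_blockSites_iff] at hxB
    have : ν x = 0 := by
      by_contra h
      exact hxS (Finset.mem_filter.2 ⟨hS (Function.mem_support.2 h), hxB⟩)
    rw [this, mul_zero]

/-- ★★ **MULTIPLIER FORM ⇒ ORTHOGONALITY FORM OF THE FLAT LANDAU CONDITION (1.38)**: if `Δ^η_1(𝟙_{Ω₀}·D^{η*}_1φ) = Q′(1)ᵀμ` on the finite `Ω₀`
(`IsLandau138 L m η Ω₀ Λs 1 φ`), then for every gauge function `λ` of `N(Q′)` — supported in `Ω₀`, `λ = 0` on `Λ₀ = Λs 0`, and with vanishing `Lʲ`-block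
sums `Σ_{x ∈ Bʲ(y)} λ(x) = 0` for `y ∈ Λs j`, `1 ≤ j ≤ m` (the flat `Q′_jλ = 0`) — the pairing `Σ_x (Δ^η_1λ)(x)·(𝟙_{Ω₀}D^{η*}_1φ)(x)` vanishes: «R D* A = 0»
with `R` the orthogonal projection onto `ΔN(Q′)`. [cite: Balaban1985RegularSpaces, (1.38) p.82, (1.29) p.81; Balaban1984PropagatorsII, (2.7) p.224, (2.10)–(2.12) p.225; Balaban1985BackgroundPropagators, (3.19) p.393, (3.24)–(3.25) p.394] -/
theorem pairing_covLap_eq_zero_of_isLandau138 {L m : ℕ} (hL : 1 ≤ L) {η : ℝ} {Ω₀ : Set (Site d)} (hΩ : Ω₀.Finite)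
    {Λs : ℕ → Set (Site d)} {φ : Site d → Fin d → ℂ} (h : IsLandau138 L m η Ω₀ Λs (1 : Site d → Fin d → ℂˣ) φ)
    {lam : Site d → ℂ} (hsupp : ∀ x, x ∉ Ω₀ → lam x = 0) (h0 : ∀ x ∈ Λs 0, lam x = 0)
    (hQ : ∀ j, 1 ≤ j → j ≤ m → ∀ y ∈ Λs j, ∑ x ∈ blockSites (L ^ j) y, lam x = 0) :
    ∑ᶠ x, covLap η (1 : Site d → Fin d → ℂˣ) lam x * Ω₀.indicator (covDivB η (1 : Site d → Fin d → ℂˣ) φ) x = 0 := by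
  classical
  obtain ⟨μ, hμ⟩ := h
  have hsuppL : (Function.support lam).Finite := hΩ.subset fun x hx => by
    by_contra h'; exact hx (hsupp x h')
  have hsuppG : (Function.support (Ω₀.indicator (covDivB η (1 : Site d → Fin d → ℂˣ) φ))).Finite :=
    hΩ.subset (Set.support_indicator_subset)
  -- move `Δ^η_1` to the other side
  rw [← finsum_mul_covLap_symm η hsuppL hsuppG]
  -- on the support of `λ` (⊂ Ω₀) the Landau identity gives the transposes
  set S := hΩ.toFinset with hSdef
  have hS : Function.support lam ⊆ ↑S := fun x hx => by
    rw [hSdef, Set.Finite.coe_toFinset]; by_contra h'; exact hx (hsupp x h')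
  rw [finsum_eq_sum_of_support_subset _ (fun x hx => hS (Function.support_mul_subset_left _ _ hx))]
  have hrow : ∀ x ∈ S, lam x * covLap η (1 : Site d → Fin d → ℂˣ) (Ω₀.indicator (covDivB η (1 : Site d → Fin d → ℂˣ) φ)) x =
      ∑ j ∈ Finset.range (m + 1), (((L : ℝ) ^ d)⁻¹) ^ j • (lam x * (Λs j).indicator (μ j) (blockMap (L ^ j) x)) := by
    intro x hx
    have hxΩ : x ∈ Ω₀ := by rw [hSdef, Set.Finite.mem_toFinset] at hx; exact hx
    rw [hμ x hxΩ, QT_flat_apply, Finset.mul_sum]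
    refine Finset.sum_congr rfl fun j _ => ?_
    rw [mul_smul_comm]
  rw [Finset.sum_congr rfl hrow, Finset.sum_comm]
  refine Finset.sum_eq_zero fun j hj => ?_
  rw [← Finset.smul_sum, smul_eq_zero]
  right
  rcases Nat.eq_zero_or_pos j with rfl | hjpos
  · -- level 0: `λ = 0` on `Λ₀`
    refine Finset.sum_eq_zero fun x _ => ?_
    rw [pow_zero, blockMap_one]
    by_cases hx0 : x ∈ Λs 0
    · rw [h0 x hx0, zero_mul]
    · rw [Set.indicator_of_notMem hx0, mul_zero]
  · -- level `j ≥ 1`: group by blocks; the block sums of `λ` vanish on `Λ_j`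
    haveI : NeZero (L ^ j) := ⟨by positivity⟩
    rw [sum_mul_comp_blockMap hS]
    refine Finset.sum_eq_zero fun y _ => ?_
    by_cases hy : y ∈ Λs j
    · rw [hQ j hjpos (by simpa [Finset.mem_range, Nat.lt_succ_iff] using hj) y hy, mul_zero]
    · rw [Set.indicator_of_notMem hy, zero_mul]

#print axioms pairing_covLap_eq_zero_of_isLandau138

end Literature.MathematicalPhysics.QuantumFieldTheory.Balaban1983to89.B8Eq138LandauFlatOrthogonal

end
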